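import Summits.BirchSwinnertonDyer.BirchSwinnertonDyer.Theorems.UniversalToricDescentRelaxedKummerImage
import Summits.BirchSwinnertonDyer.BirchSwinnertonDyer.Theorems.UniversalToricDescentRelaxedLayerTransportTorsion
import Summits.BirchSwinnertonDyer.BirchSwinnertonDyer.Theorems.UniversalToricDescentLayerDescentKernelIndex
import Summits.BirchSwinnertonDyer.BirchSwinnertonDyer.Theorems.UniversalToricDescentQuotientBoundByCoordinates
import Summits.BirchSwinnertonDyer.BirchSwinnertonDyer.Theorems.UniversalToricDescentSigmaLocalSurjective
import HarnessLib

/-!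
# The index `[KO_L(T ∪ V) : KO_L(T)]` is at most (number of `v`-signatures) × `t^{p^c}`
# (crux ♭T≤ stmt-BirchSwinnertonDyer-23042, line `sigmacongruence`, stub R1 `stub_relaxedImageCount`, brick (f) part 2 = step (c) of the relaxed count road)

Route `UniversalToricDescent`, lead prover `bsd-wall-utd-p1` g18. THEOREMS ONLY (no definition, no named fact, no `sorry`);
`--supports stmt-BirchSwinnertonDyer-23042`. BSD is not proved by any of this.

One layer `Γ_m`, `m ≥ c` (`κ(D_v) = p^c ℤ_p`, topological generator `γ`), a totally arbitrary number field `L/K` with a level-`p^k` transport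
`Φ` for `Γ_m` (Kummer dictionary `hkum`), the relaxed Kummer groups `KO_L(T) ≤ KO_L(T ∪ V)` of `…RelaxedKummerImage` (`v ∉ T_K` tame), and the
`v`-SIGNATURE `Σ z = (resKerD (conj_{γ^i} (h_m (Φ z))))_{i < p^c} ∈ H¹(ker κ|_{D_v}, E[p^∞])^{p^c}`.

* **`relIndex_kummerRelaxed_le`** — `[KO_L(T ∪ V) : KO_L(T)] ≤ #Σ(KO_L(T ∪ V)) · t^{p^c}` where `t` is ANY uniform bound for the layer kernels
  `ker(H¹(G_n, A) → H¹(ker κ|_{D_v}, A))`, `G_n = D_v ∩ Γ_n` (hypothesis `ht`, = width `utd-p1-w2`'s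
  `…LayerDescentKernelIndex.exists_forall_natCard_ker_resOfLe_le` at `G = D_v`; `A^{G_m}` finite = `…LayerFixedFinite.finite_layerFixed`).
  Proof: `Z = KO(T ∪ V) ∩ ker Σ ⊇ KO(T)` (Kummer over `v` ⟹ vanishing signature, `…RelaxedKummerImage`); `[KO(T∪V) : Z] = #Σ(KO(T∪V))`;
  on `Z` the coordinates `res_{G_m} (conj_{γ^i} Φ z) ∈ H¹(G_m, A)` lie in that kernel, and they all vanish iff `conj_σ Φ z` is locally trivial
  at `v` over `Γ_m` for EVERY `σ` (`σ = d γ^i h`, `…SigmaLocalSurjective`) iff `z` is Kummer over `v` (classical = locally trivial at tame `v`)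
  iff `z ∈ KO(T)`; so `[Z : KO(T)] ≤ t^{p^c}` (`…QuotientBoundByCoordinates`).

References: [GreenbergLNM1716] §2 Prop. 2.1, §3 Lemma 3.3 (proof, p. 87); [GreenbergVatsal2000] §2 pp. 24–25; [MilneADT2006] I.§6;
[SerreGaloisCohomology1997] I.§2.5.
-/

set_option linter.dupNamespace false
set_option autoImplicit false

noncomputable section
open scoped Classical
open CategoryTheory Field NumberField IsDedekindDomain Function
open Literature.NumberTheory.EllipticCurves Literature.NumberTheory.EllipticCurves.GreenbergSelmer
open Literature.NumberTheory.GaloisRepresentations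
open Literature.NumberTheory.GaloisRepresentations.DiscreteGaloisModule (SelmerStructure)
open Literature.NumberTheory.GaloisCohomology
open scoped ContRepresentation
open scoped NumberField.LiesOver

namespace Summit.BirchSwinnertonDyer.BirchSwinnertonDyer.Theorems.UniversalToricDescentRelaxedSignatureKernel

open Summit.BirchSwinnertonDyer.Rank1Residual.X11b Summit.BirchSwinnertonDyer.Rank1Residual.X11b.ProcyclicDescent
  Summit.BirchSwinnertonDyer.Rank1Residual.X11b.KummerPT Summit.BirchSwinnertonDyer.Rank1Residual.X11b.LocBridge
  Summit.BirchSwinnertonDyer.Rank1Residual.X11b.Coinv Summit.BirchSwinnertonDyer.Rank1Residual.X11b.AcSelmer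
  Summit.BirchSwinnertonDyer.BirchSwinnertonDyer.Theorems.SignedEC.RelaxedKummerCount
  Summit.BirchSwinnertonDyer.Rank1Residual.Additive
  Summit.BirchSwinnertonDyer.BirchSwinnertonDyer.Theorems.UniversalToricDescentTowerDescent
  Summit.BirchSwinnertonDyer.BirchSwinnertonDyer.Theorems.UniversalToricDescentRelaxedLayerTransportTorsion
  Summit.BirchSwinnertonDyer.BirchSwinnertonDyer.Theorems.UniversalToricDescentRelaxedDualTransfer
  Summit.BirchSwinnertonDyer.BirchSwinnertonDyer.Theorems.UniversalToricDescentRelaxedLayerSelmer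
  Summit.BirchSwinnertonDyer.BirchSwinnertonDyer.Theorems.UniversalToricDescentRelaxedKummerImage
  Summit.BirchSwinnertonDyer.BirchSwinnertonDyer.Theorems.UniversalToricDescentQuotientBoundByCoordinates
  Summit.BirchSwinnertonDyer.BirchSwinnertonDyer.Theorems.UniversalToricDescentSigmaLocalImage

variable {K : Type} [Field K] [NumberField K] (W : WeierstrassCurve K) [W.IsElliptic] (p k : ℕ) [Fact p.Prime]
  (κ : ZpExtension K p) (m : ℕ) (TK : Finset (HeightOneSpectrum (𝓞 K))) (v : HeightOneSpectrum (𝓞 K))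
  (L : Type) [Field L] [NumberField L] [Algebra K L]
  (TL : Finset (HeightOneSpectrum (𝓞 L))) (hTL : ∀ w, w ∈ TL ↔ w.under (𝓞 K) ∈ TK)
  (VL : Finset (HeightOneSpectrum (𝓞 L))) (hVL : ∀ w, w ∈ VL ↔ w.under (𝓞 K) = v)
  (Φ : galoisCohomology ((W.baseChange L).torsionGaloisModule ((p ^ k : ℕ) : ℤ)) 1 →+ W.subgroupH1 p (κ.layerSubgroup m))
  (hkum : ∀ (u : HeightOneSpectrum (𝓞 K)) (x : galoisCohomology ((W.baseChange L).torsionGaloisModule ((p ^ k : ℕ) : ℤ)) 1),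
    (∀ w : HeightOneSpectrum (𝓞 L), w.asIdeal.LiesOver u.asIdeal →
      galoisCohomology.res ((W.baseChange L).torsionGaloisModule ((p ^ k : ℕ) : ℤ)) (w.adicCompletion L) 1 x ∈
        (W.baseChange L).kummerLocalConditionAt ((p ^ k : ℕ) : ℤ) (w.adicCompletion L)) ↔
    ∀ σ : absoluteGaloisGroup K, W.conjH1 p (κ.layerSubgroup m) σ (Φ x) ∈ W.localKerOver p (κ.layerSubgroup m) (u.adicCompletion K))

/-! ## §1 Local triviality at `v` over `Γ_m`: the layer group `G_m = D_v ∩ Γ_m ≤ D_v` -/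

/-- `G_m = D_v ∩ Γ_m` as a subgroup of `D_v`: `g ∈ G_m ↔ p^{c+(m-c)} ∣ κ g` (`m ≥ c`). [cite: Washington1997, §13.1] -/
theorem mem_decompIn_layerSubgroup_iff {c : ℕ} (hcm : c ≤ m) (g : decomp (K := K) v) :
    g ∈ decompIn (κ.layerSubgroup m) v ↔ (p : ℤ_[p]) ^ (c + (m - c)) ∣ (kappaD κ v g).toAdd := by
  rw [mem_decompIn_iff, ZpExtension.mem_layerSubgroup, kappaD_apply, Nat.add_sub_cancel' hcm]

/-- The inclusion `G_m = D_v ∩ Γ_m → Γ_m`, continuous. [folklore] -/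
theorem continuous_decompIn_val :
    Continuous fun g : decompIn (κ.layerSubgroup m) v ↦
      (⟨((g : decomp (K := K) v) : absoluteGaloisGroup K), (mem_decompIn_iff _ v _).mp g.2⟩ : κ.layerSubgroup m) :=
  (continuous_subtype_val.comp continuous_subtype_val).subtype_mk _

include hkum hTL hVL in
/-- **`[KO_L(T ∪ V) : KO_L(T)] ≤ #Σ(KO_L(T ∪ V)) · t^{p^c}`** (module docstring). [cite: GreenbergLNM1716, §2 Prop. 2.1, §3 Lemma 3.3 (p. 87)]
[cite: GreenbergVatsal2000, §2 pp. 24–25] [cite: MilneADT2006, Ch. I §6] -/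
theorem relIndex_kummerRelaxed_le (hvT : v ∉ TK) (hpv : ((p : ℕ) : 𝓞 K) ∉ v.asIdeal)
    {γ : absoluteGaloisGroup K} (hγ : κ.IsTopGenerator γ) {c : ℕ} (hcm : c ≤ m)
    (hc : ∀ z : ℤ_[p], ∃ d : decomp (K := K) v, (κ (d : absoluteGaloisGroup K)).toAdd = (p : ℤ_[p]) ^ c * z)
    (hFIN : Finite {a : W.geomPrimaryTorsion p //
      ∀ g : decomp (K := K) v, g ∈ decompIn (κ.layerSubgroup m) v → g • a = a})
    {t : ℕ}
    (ht : ∀ (n : ℕ) (Gn : Subgroup (decomp (K := K) v))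
      (hGn : ∀ g : decomp (K := K) v, g ∈ Gn ↔ (p : ℤ_[p]) ^ (c + n) ∣ (kappaD κ v g).toAdd),
      IsClosed (Gn : Set (decomp (K := K) v)) → Finite {a : W.geomPrimaryTorsion p // ∀ g : decomp (K := K) v, g ∈ Gn → g • a = a} →
        Finite (resOfLe (W.geomPrimaryTorsion p) (kerK_le_layer (kappaD κ v) hGn)).ker ∧
          Nat.card (resOfLe (W.geomPrimaryTorsion p) (kerK_le_layer (kappaD κ v) hGn)).ker ≤ t) :
    ((kummerRelaxed (W.baseChange L) (p ^ k) (TL.image Sum.inr ∪ Finset.univ.image Sum.inl)).selmerGroup).relIndex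
        (kummerRelaxed (W.baseChange L) (p ^ k) ((TL.image Sum.inr ∪ Finset.univ.image Sum.inl) ∪ VL.image Sum.inr)).selmerGroup ≤
      Nat.card ((AddMonoidHom.pi fun i : Fin (p ^ c) ↦
            (resKerD κ (W.geomPrimaryTorsion p) v).comp ((W.conjH1 p κ.kerSubgroup (γ ^ (i : ℕ))).comp
              ((W.layerToInfty κ m).comp Φ))).comp
          (kummerRelaxed (W.baseChange L) (p ^ k)
            ((TL.image Sum.inr ∪ Finset.univ.image Sum.inl) ∪ VL.image Sum.inr)).selmerGroup.subtype).range *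
        t ^ (p ^ c) := by
  classical
  set A := W.geomPrimaryTorsion p with hA
  set KOT := (kummerRelaxed (W.baseChange L) (p ^ k) (TL.image Sum.inr ∪ Finset.univ.image Sum.inl)).selmerGroup with hKOT
  set KOV := (kummerRelaxed (W.baseChange L) (p ^ k) ((TL.image Sum.inr ∪ Finset.univ.image Sum.inl) ∪ VL.image Sum.inr)).selmerGroup
    with hKOV
  set Sig : galoisCohomology ((W.baseChange L).torsionGaloisModule ((p ^ k : ℕ) : ℤ)) 1 →+ (Fin (p ^ c) → subgroupH1 (kerD κ v) A) :=
    AddMonoidHom.pi fun i : Fin (p ^ c) ↦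
      (resKerD κ A v).comp ((W.conjH1 p κ.kerSubgroup (γ ^ (i : ℕ))).comp ((W.layerToInfty κ m).comp Φ)) with hSig
  have hSig_apply : ∀ z i, Sig z i = resKerD κ A v (W.conjH1 p κ.kerSubgroup (γ ^ (i : ℕ)) (W.layerToInfty κ m (Φ z))) :=
    fun _ _ ↦ rfl
  -- `Z = KO(T ∪ V) ∩ ker Σ`
  let Z : AddSubgroup (galoisCohomology ((W.baseChange L).torsionGaloisModule ((p ^ k : ℕ) : ℤ)) 1) := KOV ⊓ Sig.ker
  have hKOT_le_KOV : KOT ≤ KOV := fun z hz ↦ ((mem_kummerRelaxed_iff_mem_union W p k TK v L TL hTL VL hVL hvT z).mp hz).1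
  have hKOT_le_Z : KOT ≤ Z := by
    intro z hz
    refine ⟨hKOT_le_KOV hz, (AddMonoidHom.mem_ker).mpr ?_⟩
    funext i
    rw [hSig_apply]
    exact resKerD_conjH1_layerToInfty_eq_zero_of_mem_kummerRelaxed W p k TK v L TL hTL VL hVL κ m Φ hkum hvT hpv hz _
  have hZ_le_KOV : Z ≤ KOV := inf_le_left
  -- (1) `[KOV : Z] = #Σ(KOV)`
  have h1 : Z.relIndex KOV = Nat.card (Sig.comp KOV.subtype).range := by
    rw [AddSubgroup.relIndex, AddSubgroup.index]
    have hker : (Sig.comp KOV.subtype).ker = Z.addSubgroupOf KOV := by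
      ext x
      rw [AddMonoidHom.mem_ker, AddSubgroup.mem_addSubgroupOf, AddMonoidHom.comp_apply]
      exact ⟨fun h ↦ ⟨x.2, (AddMonoidHom.mem_ker).mpr h⟩, fun h ↦ (AddMonoidHom.mem_ker).mp h.2⟩
    rw [← hker]
    exact Nat.card_congr (QuotientAddGroup.quotientKerEquivRange (Sig.comp KOV.subtype)).toEquiv
  -- (2) `[Z : KOT] ≤ t^{p^c}`: the layer group `G_m ≤ D_v` and the coordinates in `ker(H¹(G_m, A) → H¹(kerD, A))`
  set Gn : Subgroup (decomp (K := K) v) := decompIn (κ.layerSubgroup m) v with hGndef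
  have hGn : ∀ g : decomp (K := K) v, g ∈ Gn ↔ (p : ℤ_[p]) ^ (c + (m - c)) ∣ (kappaD κ v g).toAdd :=
    mem_decompIn_layerSubgroup_iff p κ m v hcm
  have hGc : IsClosed (Gn : Set (decomp (K := K) v)) := by
    have e : (Gn : Set (decomp (K := K) v)) = Subtype.val ⁻¹' (κ.layerSubgroup m : Set (absoluteGaloisGroup K)) := by
      ext g; exact mem_decompIn_iff _ v g
    rw [e]
    exact ((κ.layerSubgroup m).isClosed_of_isOpen (κ.isOpen_layerSubgroup m)).preimage continuous_subtype_val
  obtain ⟨hkerfin, hkerle⟩ := ht (m - c) Gn hGn hGc hFIN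
  haveI := hkerfin
  -- the restriction `H¹(Γ_m, A) → H¹(G_m, A)`
  let θ : Gn →ₜ* κ.layerSubgroup m :=
    { toFun := fun g ↦ ⟨((g : decomp (K := K) v) : absoluteGaloisGroup K), (mem_decompIn_iff _ v _).mp g.2⟩
      map_one' := rfl
      map_mul' := fun _ _ ↦ rfl
      continuous_toFun := continuous_decompIn_val p κ m v }
  let resGn : W.subgroupH1 p (κ.layerSubgroup m) →+ subgroupH1 Gn A := resH1Hom θ (AddMonoidHom.id A) (fun _ _ ↦ rfl)
  -- (I1) `res_{kerD ≤ G_m} ∘ res_{G_m} = resKerD ∘ h_m`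
  have hI1 : ∀ c' : W.subgroupH1 p (κ.layerSubgroup m),
      resOfLe A (kerK_le_layer (kappaD κ v) hGn) (resGn c') = resKerD κ A v (W.layerToInfty κ m c') := by
    intro c'
    rw [WeierstrassCurve.layerToInfty, WeierstrassCurve.resOfLe, resKerD, resOfLe, resOfLe, resH1Hom_resH1Hom, resH1Hom_resH1Hom]
    exact DFunLike.congr_fun (resH1Hom_congr (ContinuousMonoidHom.ext fun _ ↦ rfl) (by ext; rfl) _ _) c'
  -- (I2) `res_{G_m} c' = 0 ↔ c' ∈ awayKer Γ_m A v`
  have hI2 : ∀ c' : W.subgroupH1 p (κ.layerSubgroup m), resGn c' = 0 ↔ c' ∈ awayKer (κ.layerSubgroup m) A v := by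
    intro c'
    rw [awayKer, AddMonoidHom.mem_ker, resOfLe]
    refine resH1Hom_eq_zero_iff_of_range_eq _ _ _ Function.bijective_id _ _ _ Function.bijective_id ?_ c'
    ext g
    constructor
    · rintro ⟨x, rfl⟩
      exact ⟨⟨(x : decomp (K := K) v), Subgroup.mem_inf.mpr ⟨(mem_decompIn_iff _ v _).mp x.2, (x : decomp (K := K) v).2⟩⟩, rfl⟩
    · rintro ⟨x, rfl⟩
      obtain ⟨hxm, hxD⟩ := Subgroup.mem_inf.mp x.2
      exact ⟨⟨⟨(x : absoluteGaloisGroup K), hxD⟩, (mem_decompIn_iff _ v _).mpr hxm⟩, rfl⟩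
  -- the coordinate map on `Z`
  let ρi : Fin (p ^ c) → (galoisCohomology ((W.baseChange L).torsionGaloisModule ((p ^ k : ℕ) : ℤ)) 1 →+ subgroupH1 Gn A) :=
    fun i ↦ resGn.comp ((W.conjH1 p (κ.layerSubgroup m) (γ ^ (i : ℕ))).comp Φ)
  let ρ : Z →+ (Fin (p ^ c) → subgroupH1 Gn A) := (AddMonoidHom.pi ρi).comp Z.subtype
  have hρ : ∀ (z : Z) (i : Fin (p ^ c)), ρ z i = resGn (W.conjH1 p (κ.layerSubgroup m) (γ ^ (i : ℕ)) (Φ z)) := fun _ _ ↦ rfl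
  have hS : ∀ (z : Z) (i : Fin (p ^ c)), ρ z i ∈ (resOfLe A (kerK_le_layer (kappaD κ v) hGn)).ker := by
    intro z i
    rw [AddMonoidHom.mem_ker, hρ, hI1]
    have hz : Sig (z : galoisCohomology ((W.baseChange L).torsionGaloisModule ((p ^ k : ℕ) : ℤ)) 1) = 0 :=
      (AddMonoidHom.mem_ker).mp z.2.2
    have h := congr_fun hz i
    rw [hSig_apply] at h
    have e := congrArg (fun f ↦ f (Φ z)) (resOfLe_comp_conjH1_holds (M := A) (κ.kerSubgroup_le_layerSubgroup m) (γ ^ (i : ℕ)))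
    simp only [AddMonoidHom.coe_comp, Function.comp_apply] at e
    change resKerD κ A v (resOfLe A (κ.kerSubgroup_le_layerSubgroup m) (conjH1 (κ.layerSubgroup m) A (γ ^ (i : ℕ)) (Φ z))) = 0
    rw [e]
    exact h
  have hF : ∀ z : Z, ρ z = 0 → (z : galoisCohomology ((W.baseChange L).torsionGaloisModule ((p ^ k : ℕ) : ℤ)) 1) ∈ KOT := by
    intro z hz
    rw [mem_kummerRelaxed_iff_mem_union W p k TK v L TL hTL VL hVL hvT]
    refine ⟨z.2.1, (hkum v _).mpr fun σ ↦ ?_⟩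
    rw [localKerOver_layer_eq_awayKer W p κ m hpv]
    -- `σ = d γ^i h`
    obtain ⟨d, i, h, hi, hh, rfl⟩ := exists_decomp_mul_pow_lt_mul_mem_ker κ hγ v hc σ
    have hγi : W.conjH1 p (κ.layerSubgroup m) (γ ^ i) (Φ z) ∈ awayKer (κ.layerSubgroup m) A v := by
      rw [← hI2]
      have := congr_fun hz ⟨i, hi⟩
      rw [hρ] at this
      exact this
    rw [W.conjH1_mul_holds p (κ.layerSubgroup m), W.conjH1_mul_holds p (κ.layerSubgroup m), AddMonoidHom.comp_apply,
      AddMonoidHom.comp_apply, W.conjH1_of_mem_holds p (κ.layerSubgroup m) (κ.kerSubgroup_le_layerSubgroup m hh), AddMonoidHom.id_apply,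
      awayKer, AddMonoidHom.mem_ker,
      ← resOfLe_inf_eq_zero_iff_conjH1 (κ.layerSubgroup m) (decomp v) (decomp v) (d : absoluteGaloisGroup K)
        (fun g ↦ ⟨fun hg ↦ mul_mem (mul_mem d.2 hg) (inv_mem d.2), fun hg ↦ by
          have e : g = (d : absoluteGaloisGroup K)⁻¹ * ((d : absoluteGaloisGroup K) * g * (d : absoluteGaloisGroup K)⁻¹) * d := by group
          rw [e]
          exact mul_mem (mul_mem (inv_mem d.2) hg) d.2⟩)]
    rw [awayKer, AddMonoidHom.mem_ker] at hγi
    exact hγi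
  obtain ⟨-, h2⟩ := natCard_quotient_addSubgroupOf_le_pow (D' := Z) (F := KOT) ρ
    (fun _ ↦ (resOfLe A (kerK_le_layer (kappaD κ v) hGn)).ker) hS (t := t) (fun _ ↦ hkerle) hF
  -- (3) combine
  have hmul := AddSubgroup.relIndex_mul_relIndex KOT Z KOV hKOT_le_Z hZ_le_KOV
  rw [← hmul, h1, mul_comm]
  exact Nat.mul_le_mul_left _ h2

end Summit.BirchSwinnertonDyer.BirchSwinnertonDyer.Theorems.UniversalToricDescentRelaxedSignatureKernel

end
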